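import Mathlib
import Literature.Analysis.FluidPDE.ChoiEtAl2017PeriodicHouLuoReflection
import Literature.Analysis.FluidPDE.ChoiEtAl2017PeriodicHouLuoUniqueness
import Literature.Analysis.FluidPDE.ChoiEtAl2017PeriodicHouLuoLemma7
import HarnessLib

/-!
# Choi–Hou–Kiselev–Luo–Šverák–Yao 2017, Theorem 1 (periodic case): the discharge
# `choiEtAl2017_periodicHouLuo_blowup_holds`

HONEST FRAMING (cell ns-blowup GROUP B «PROFILE SEARCH», zones Z3-b′ / Z8 = the Hou–Luo boundary
MODEL): **1-D MODEL (Hou–Luo), not Euler/NS.** Source: K. Choi, T. Y. Hou, A. Kiselev, G. Luo,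
V. Šverák, Y. Yao, Comm. Pure Appl. Math. **70** (2017) 2218–2243 = arXiv:1407.4776
[ChoiHouKiselevLuoSverakYao2017], Thm 1 p. 6 and its proof §4 pp. 11–13.

This file discharges the named fact `choiEtAl2017_periodicHouLuo_blowup`
(`ChoiEtAl2017PeriodicHouLuoBlowup`): for every period `L` and every datum of the printed class
`IsBlowupDatum` there is no global smooth `L`-periodic solution of the HL model. The proof is the
printed one, assembled from the sibling files: the conditional assembly
`not_isGlobalSmooth_of_unique_of_lemma7` (`…Reflection`, built on `…Assembly`, `…Functional`,
`…SignPreservation`, `…Kernel`, `…Velocity`), fed with (U) uniqueness of global smooth periodic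
solutions (`IsGlobalSmoothPeriodicHouLuoSolution.unique`, `…Uniqueness`, in print "local
well-posedness", §2 p. 6) and (E) Lemma 7 (`ChoiEtAl2017.lemma7`, `…Lemma7`). It lives in its own
file because `…Blowup` (which states the fact) is imported by all of these.

WHAT THIS IS NOT: not Euler, not Navier–Stokes; no claim about NS regularity or blow-up — a
theorem about the 1-D periodic wall MODEL. `violates:` none — MODEL. Net debt −1 (no new
definitions, no new facts).
-/

noncomputable section

open Set

namespace Literature.Analysis.FluidPDE

/-- **CHKLSY 2017 Theorem 1 (periodic case) holds**: the named fact
`choiEtAl2017_periodicHouLuo_blowup` — for every `L` and every datum `(ω₀, θ₀)` of the class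
`ChoiEtAl2017.IsBlowupDatum L ω₀ θ₀`, no pair `(ω, θ)` is a global smooth `L`-periodic solution of
the Hou–Luo model from that datum — is a theorem: reflection symmetry + uniqueness keep `ω(t)` odd
and `θ_x(t)` odd, Lemma 7 and the functional inequalities force `I(t) = ∫₀^{L/2} θ cot(μx) dx` to
blow up in finite time. [cite: ChoiHouKiselevLuoSverakYao2017, §2.1 Thm 1 p. 6 and §4 pp. 11–13 (proof of Thm 1, periodic setting)] -/
theorem choiEtAl2017_periodicHouLuo_blowup_holds : choiEtAl2017_periodicHouLuo_blowup := by
  intro L ω₀ θ₀ hdat ω θ hsol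
  exact ChoiEtAl2017.not_isGlobalSmooth_of_unique_of_lemma7 hdat hsol
    (fun ω' θ' h' t ht => IsGlobalSmoothPeriodicHouLuoSolution.unique hdat.L_pos h' hsol t ht)
    (ChoiEtAl2017.lemma7 hdat.L_pos)

/-- **Theorem 1 (periodic case) as printed, now unconditional**: for every period `L > 0` there are
smooth `L`-periodic data from which the HL model has no global smooth `L`-periodic solution (the
cosine datum `isBlowupDatum_cosine`). [cite: ChoiHouKiselevLuoSverakYao2017, §2.1 Thm 1 p. 6] -/
theorem choiEtAl2017_periodicHouLuo_exists_blowup_datum {L : ℝ} (hL : 0 < L) :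
    ∃ ω₀ θ₀ : ℝ → ℝ, ContDiff ℝ (⊤ : ℕ∞) ω₀ ∧ ContDiff ℝ (⊤ : ℕ∞) θ₀ ∧
      Function.Periodic ω₀ L ∧ Function.Periodic θ₀ L ∧
      ∀ ω θ : ℝ → ℝ → ℝ, ¬ IsGlobalSmoothPeriodicHouLuoSolution L ω₀ θ₀ ω θ :=
  choiEtAl2017_periodicHouLuo_blowup_holds.exists_datum hL

/-- **The periodic HL MODEL launched from the Luo–Hou wall trace has no global smooth solution**,
now unconditional: datum `(0, 10⁴ sin²(2πz/L))`, period `L/2` (`isBlowupDatum_luoHouWall`). A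
statement about the 1-D wall MODEL, not about the 3-D Euler computation.
[cite: ChoiHouKiselevLuoSverakYao2017, §2.1 Thm 1 p. 6 and §4 p. 11] [cite: LuoHou2014, §5 (arXiv:1310.0497 p0024 L40)] -/
theorem luoHou_wallModel_noGlobalSmoothPeriodicHouLuoSolution (ω θ : ℝ → ℝ → ℝ) :
    ¬ IsGlobalSmoothPeriodicHouLuoSolution (LuoHou2014.periodL / 2) 0 LuoHou2014.wallModelInitialU
      ω θ :=
  choiEtAl2017_periodicHouLuo_blowup_holds.luoHou_wallModel ω θ

end Literature.Analysis.FluidPDE
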